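import Literature.Analysis.InnerProduct.HilbertComplexEigenvalueComparison
import Literature.Analysis.InnerProduct.HilbertComplexMaps
import HarnessLib

/-!
# The compactness (Rellich) property of a Hilbert complex is an isomorphism invariant (Brüning–Lesch 1992,
# Lemma 2.17: "Discreteness is invariant under complex isomorphisms" — the compactness half, through the splitting
# `k = h ⊕ g` of (2.50): `g` on the coexact side, `h = (g⁻¹)*` on the exact side)

Layer `Literature/Analysis/InnerProduct`, namespace `Literature.Analysis.InnerProduct`; sequel BY NAME of
`HilbertComplexEigenvalueComparison.lean` (row g34-#7: `adjoint_map_of_map`, "`h := (g⁻¹)*` is also a complex map"),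
`HilbertComplexMaps.lean` (row g34-#3: `apply_mem_pmapKer_of_map`, `apply_mem_closure_range_of_map`),
`ClosedDenselyDefinedHilbertComplex.lean` (`orthogonal_range_eq_ker_adjoint`, `closure_range_le_ker`, `isClosed_pmapKer`)
and, for the property itself, `HilbertComplexFormEmbeddingCompact.lean` (row g32: `exists_tendsto_subseq_of_form_bounded`,
Rellich for a discrete complex — its CONCLUSION is the hypothesis `hR` below) and `HilbertComplexBasicEstimate.lean` /
`HilbertComplexCompactnessProperty.lean` (rows g31-#7/#11: what the property gives). Lane `lit-hodgefound` (Track 2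
foundations library), prover seat `lit-hodgefound-p06` (generation 34), self-proposed row g34-#10. THEOREMS ONLY (no
definition, no instance, no named fact). The "compactness property" of a short complex `0 → E →T F →S G → 0` is taken in
the sequential (Rellich) form in which the tree produces and consumes it: every sequence `uₙ ∈ D(T*) ∩ D(S)` with
`‖uₙ‖² + ‖T*uₙ‖² + ‖Suₙ‖² ≤ C²` has a convergent subsequence; in degree `0` the form is `‖w‖² + ‖Tw‖²` on `D(T)`, in
degree `2` it is `‖z‖² + ‖S*z‖²` on `D(S*)`.

## Source, verbatim

J. Brüning, M. Lesch, *Hilbert complexes*, J. Funct. Anal. 108 (1992), §2 pp. 103–104 (held text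
`paper:doi-10-1016-0022-1236-92-90147-b`, p0016–p0017): "consider a complex isomorphism `g : (𝒟, D) → (𝒟′, D′)` and the
corresponding map `⊕_{i≥0} g_i^1 ⊕ g_i^2 ⊕ ĝ_i : H → H′` (2.50), which preserves the weak Hodge decomposition according
to Lemma 2.7. Then observe that `h := (g⁻¹)* : (𝒟*, D*) → (𝒟′*, D′*)` is also a complex isomorphism. … the bilinear form
generated by `Δ_i` on `𝒟_i ∩ 𝒟*_{i−1}` is simply `C^{(i)}(u | u) := ‖D_i u‖² + ‖D*_{i−1} u‖² = ‖D_i u₂‖² + ‖D*_{i−1} u₁‖²`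
if `u = u₁ + u₂ + u₃ ∈ …` … LEMMA 2.17. Discreteness is invariant under complex isomorphisms." And Cor 2.19: "`spec_e Δ′ =
∅` iff the same property holds for `Δ`."

## What is proved (all over `𝕜 = ℝ` or `ℂ`)

* §1 **`rellich_degree_zero_of_iso`**: if `(k_E, k_F)` is a map of complexes `(T′) → (T)` with `g_E ∘ k_E = id` (`g_E`
  bounded), the Rellich property of `‖·‖² + ‖T·‖²` on `D(T)` passes to `T′` (`w′ₙ ↦ k_E w′ₙ` is form-bounded,
  `w′ₙ = g_E k_E w′ₙ`).
* §2 **`rellich_degree_two_of_iso`**: the same for `‖·‖² + ‖S*·‖²` on `D(S*)` through `h = g_G*` (`S*g_G* = g_F*S′*` by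
  `adjoint_map_of_map`, `z′ = k_G*g_G*z′`).
* §3 **`rellich_of_iso`** (middle degree): for an isomorphism of Hilbert complexes (`T, T′` densely defined, `S, S′` closed,
  `Im T ⊆ Ker S`, `Im T′ ⊆ Ker S′`; data `hgT`, `hkT`, `hkS`, `g_F ∘ k_F = id`) the Rellich property of
  `‖·‖² + ‖T*·‖² + ‖S·‖²` on `D(T*) ∩ D(S)` passes to `(T′, S′)`. Proof = BL92's splitting made sequential: write
  `u′ₙ = a′ₙ + b′ₙ` with `a′ₙ = P_{Ker T′*}u′ₙ ∈ Ker T′* ∩ D(S′)`, `b′ₙ = P_{cl Im T′}u′ₙ ∈ cl Im T′ ∩ D(T′*)`; then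
  `vₙ := P_{Ker T*}k_F a′ₙ` and `wₙ := P_{cl Im T}g_F*b′ₙ` are form-bounded for `(T, S)` (`Svₙ = k_G S′u′ₙ`, `T*vₙ = 0`;
  `T*wₙ = g_E*T′*u′ₙ`, `Swₙ = 0`), so they converge along a common subsequence, and `a′ₙ = P_{Ker T′*}g_F vₙ`,
  `b′ₙ = P_{cl Im T′}k_F*wₙ` recover `u′ₙ` continuously (`g_F` maps `cl Im T` into `cl Im T′`, `k_F*` maps `Ker T*` into
  `Ker T′*`, `g_F k_F = id`, `k_F*g_F* = id`).
NOT in this file: the passage from the Rellich property of `(T′, S′)` back to a compact resolvent / an eigenbasis of `□′`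
(the tree's `exists_hilbertBasis_laplacian_eigenvectors` wants `IsCompactOperator` of the resolvent) — next row.

## References

* [BruningLesch1992] J. Brüning, M. Lesch, *Hilbert complexes*, J. Funct. Anal. 108 (1992) 88–132, §2 Lemma 2.7, (2.50)–(2.51),
  Lemma 2.17, Cor 2.19.
* [ArnoldFalkWinther2010] D. N. Arnold, R. S. Falk, R. Winther, Bull. AMS 47 (2010), §3.1 (the compactness property).
* [Schmudgen2012] K. Schmüdgen, *Unbounded Self-adjoint Operators on Hilbert Space*, Prop. 10.6 (compact form embedding ⟺
  discrete spectrum).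
-/

noncomputable section

open scoped InnerProductSpace LinearPMap
open Filter Topology

namespace Literature.Analysis.InnerProduct

variable {𝕜 E F G E' F' G' : Type*} [RCLike 𝕜]
variable [NormedAddCommGroup E] [InnerProductSpace 𝕜 E]
variable [NormedAddCommGroup F] [InnerProductSpace 𝕜 F]
variable [NormedAddCommGroup G] [InnerProductSpace 𝕜 G]
variable [NormedAddCommGroup E'] [InnerProductSpace 𝕜 E']
variable [NormedAddCommGroup F'] [InnerProductSpace 𝕜 F']
variable [NormedAddCommGroup G'] [InnerProductSpace 𝕜 G']

variable {T : E →ₗ.[𝕜] F} {S : F →ₗ.[𝕜] G} {T' : E' →ₗ.[𝕜] F'} {S' : F' →ₗ.[𝕜] G'}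
variable {g_E : E →L[𝕜] E'} {g_F : F →L[𝕜] F'} {g_G : G →L[𝕜] G'}
  {k_E : E' →L[𝕜] E} {k_F : F' →L[𝕜] F} {k_G : G' →L[𝕜] G}

/-! ### §0 Plumbing -/

omit [RCLike 𝕜] in
/-- From `a² + (b² + c²) ≤ C²` with `a, b, c ≥ 0`: `a, b, c ≤ |C|`. [folklore] -/
private theorem le_abs_of_form_bound {a b c C : ℝ} (h : a ^ 2 + (b ^ 2 + c ^ 2) ≤ C ^ 2) :
    a ≤ |C| ∧ b ≤ |C| ∧ c ≤ |C| := by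
  have hC : 0 ≤ |C| := abs_nonneg C
  have hC2 : C ^ 2 = |C| ^ 2 := (sq_abs C).symm
  rw [hC2] at h
  refine ⟨?_, ?_, ?_⟩ <;> nlinarith [sq_nonneg a, sq_nonneg b, sq_nonneg c]

omit [NormedAddCommGroup E] [InnerProductSpace 𝕜 E] [NormedAddCommGroup G] [InnerProductSpace 𝕜 G]
  [NormedAddCommGroup E'] [InnerProductSpace 𝕜 E'] [NormedAddCommGroup F'] [InnerProductSpace 𝕜 F']
  [NormedAddCommGroup G'] [InnerProductSpace 𝕜 G'] in
/-- `P_K y = 0` for `y ⊥ K`. [folklore] -/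
private theorem starProjection_eq_zero_of_mem_orthogonal {K : Submodule 𝕜 F} [K.HasOrthogonalProjection] {y : F}
    (hy : y ∈ Kᗮ) : K.starProjection y = 0 := by
  have h := Submodule.starProjection_orthogonal_val (K := K) y
  rw [Submodule.starProjection_eq_self_iff.2 hy] at h
  exact sub_eq_self.1 h.symm

omit [NormedAddCommGroup G] [InnerProductSpace 𝕜 G] [NormedAddCommGroup E'] [InnerProductSpace 𝕜 E']
  [NormedAddCommGroup F'] [InnerProductSpace 𝕜 F'] [NormedAddCommGroup G'] [InnerProductSpace 𝕜 G'] in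
/-- `k ∘ g = id ⇒ g* ∘ k* = id` (pointwise). [folklore] -/
private theorem adjoint_apply_adjoint_apply_of_leftInverse [CompleteSpace E] [CompleteSpace F] {g : E →L[𝕜] F}
    {k : F →L[𝕜] E} (hkg : ∀ x : E, k (g x) = x) (z : E) :
    ContinuousLinearMap.adjoint g (ContinuousLinearMap.adjoint k z) = z := by
  refine ext_inner_right 𝕜 fun x ↦ ?_
  rw [ContinuousLinearMap.adjoint_inner_left, ContinuousLinearMap.adjoint_inner_left, hkg]

omit [NormedAddCommGroup G] [InnerProductSpace 𝕜 G] [NormedAddCommGroup E'] [InnerProductSpace 𝕜 E']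
  [NormedAddCommGroup F'] [InnerProductSpace 𝕜 F'] [NormedAddCommGroup G'] [InnerProductSpace 𝕜 G'] in
/-- `‖A*y‖ ≤ ‖A‖‖y‖`. [folklore] -/
private theorem norm_adjoint_apply_le_opNorm [CompleteSpace E] [CompleteSpace F] (A : E →L[𝕜] F) (y : F) :
    ‖ContinuousLinearMap.adjoint A y‖ ≤ ‖A‖ * ‖y‖ := by
  have h := (ContinuousLinearMap.adjoint A).le_opNorm y
  rwa [LinearIsometryEquiv.norm_map] at h

/-! ### §1 Degree `0`: the Rellich property of `‖w‖² + ‖Tw‖²` on `D(T)` passes along an isomorphism -/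

omit [NormedAddCommGroup G] [InnerProductSpace 𝕜 G] [NormedAddCommGroup G'] [InnerProductSpace 𝕜 G'] in
/-- **Degree `0`**: if bounded `k_E : E′ → E`, `k_F : F′ → F` form a map of complexes `(T′) → (T)` (`T k_E = k_F T′` on
`D(T′)`) and `g_E ∘ k_E = id` with `g_E` bounded, then the Rellich property of `T` ("every sequence bounded in
`‖w‖² + ‖Tw‖²` has a convergent subsequence") implies that of `T′`: `k_E w′ₙ` is form-bounded (`T k_E w′ₙ = k_F T′w′ₙ`),
a subsequence converges, and `w′ₙ = g_E(k_E w′ₙ)` converges with it. [cite: BruningLesch1992, §2 Lemma 2.17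
("Discreteness is invariant under complex isomorphisms"), (2.51) (`‖D′ g u‖ = ‖g D u‖ ≤ C‖Du‖`); Schmudgen2012, Prop. 10.6] -/
theorem rellich_degree_zero_of_iso
    (hkT : ∀ (w' : E') (hw' : w' ∈ T'.domain), ∃ h : k_E w' ∈ T.domain, T ⟨k_E w', h⟩ = k_F (T' ⟨w', hw'⟩))
    (hgk_E : ∀ w' : E', g_E (k_E w') = w')
    (hR : ∀ (w : ℕ → E) (hw : ∀ n, w n ∈ T.domain) (C : ℝ),
      (∀ n, ‖w n‖ ^ 2 + ‖T ⟨w n, hw n⟩‖ ^ 2 ≤ C ^ 2) →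
        ∃ v : E, ∃ φ : ℕ → ℕ, StrictMono φ ∧ Tendsto (w ∘ φ) atTop (𝓝 v))
    (w' : ℕ → E') (hw' : ∀ n, w' n ∈ T'.domain) (C : ℝ)
    (hC : ∀ n, ‖w' n‖ ^ 2 + ‖T' ⟨w' n, hw' n⟩‖ ^ 2 ≤ C ^ 2) :
    ∃ v' : E', ∃ φ : ℕ → ℕ, StrictMono φ ∧ Tendsto (w' ∘ φ) atTop (𝓝 v') := by
  have hx : ∀ n, k_E (w' n) ∈ T.domain := fun n ↦ (hkT (w' n) (hw' n)).1
  have hxT : ∀ n, T ⟨k_E (w' n), hx n⟩ = k_F (T' ⟨w' n, hw' n⟩) := fun n ↦ (hkT (w' n) (hw' n)).2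
  have hb : ∀ n, ‖w' n‖ ≤ |C| ∧ ‖T' ⟨w' n, hw' n⟩‖ ≤ |C| := fun n ↦ by
    have h := le_abs_of_form_bound (a := ‖w' n‖) (b := ‖T' ⟨w' n, hw' n⟩‖) (c := 0) (C := C)
      (by simpa using hC n)
    exact ⟨h.1, h.2.1⟩
  obtain ⟨v, φ, hφ, hv⟩ := hR (fun n ↦ k_E (w' n)) hx (‖k_E‖ * |C| + ‖k_F‖ * |C|) fun n ↦ by
    have h1 : ‖k_E (w' n)‖ ≤ ‖k_E‖ * |C| :=
      (k_E.le_opNorm _).trans (mul_le_mul_of_nonneg_left (hb n).1 (norm_nonneg _))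
    have h2 : ‖T ⟨k_E (w' n), hx n⟩‖ ≤ ‖k_F‖ * |C| := by
      rw [hxT n]
      exact (k_F.le_opNorm _).trans (mul_le_mul_of_nonneg_left (hb n).2 (norm_nonneg _))
    have h3 : 0 ≤ ‖k_E‖ * |C| := by positivity
    have h4 : 0 ≤ ‖k_F‖ * |C| := by positivity
    nlinarith [norm_nonneg (k_E (w' n)), norm_nonneg (T ⟨k_E (w' n), hx n⟩)]
  refine ⟨g_E v, φ, hφ, ?_⟩
  have hfun : w' ∘ φ = fun n ↦ g_E ((fun n ↦ k_E (w' n)) (φ n)) := by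
    funext n
    simp only [Function.comp_apply, hgk_E]
  rw [hfun]
  exact (g_E.continuous.tendsto v).comp hv

/-! ### §2 Degree `2`: the Rellich property of `‖z‖² + ‖S*z‖²` on `D(S*)` passes along an isomorphism, through
`h = g_G*` -/

omit [NormedAddCommGroup E] [InnerProductSpace 𝕜 E] [NormedAddCommGroup E'] [InnerProductSpace 𝕜 E'] in
/-- **Degree `2`**: if `(g_F, g_G)` is a map of complexes `(S) → (S′)` (`S′g_F = g_G S` on `D(S)`, `S`, `S′` densely
defined) and `g_G ∘ k_G = id` with `k_G` bounded, the Rellich property of `‖z‖² + ‖S*z‖²` on `D(S*)` implies that of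
`S′*`: `g_G*` maps `D(S′*)` into `D(S*)` with `S*g_G* = g_F*S′*` ("`h := (g⁻¹)*` is also a complex isomorphism"),
`g_G*z′ₙ` is form-bounded, and `z′ₙ = k_G*(g_G*z′ₙ)`. [cite: BruningLesch1992, §2 Lemma 2.17, p. 103 (`h := (g⁻¹)*`),
(2.51) (`‖(g⁻¹)* D* u‖`); Schmudgen2012, Prop. 10.6] -/
theorem rellich_degree_two_of_iso [CompleteSpace F] [CompleteSpace G] [CompleteSpace F'] [CompleteSpace G']
    (hdS : Dense (S.domain : Set F)) (hdS' : Dense (S'.domain : Set F'))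
    (hgS : ∀ (u : F) (hu : u ∈ S.domain), ∃ h : g_F u ∈ S'.domain, S' ⟨g_F u, h⟩ = g_G (S ⟨u, hu⟩))
    (hgk_G : ∀ z' : G', g_G (k_G z') = z')
    (hR : ∀ (z : ℕ → G) (hz : ∀ n, z n ∈ S†.domain) (C : ℝ),
      (∀ n, ‖z n‖ ^ 2 + ‖S† ⟨z n, hz n⟩‖ ^ 2 ≤ C ^ 2) →
        ∃ v : G, ∃ φ : ℕ → ℕ, StrictMono φ ∧ Tendsto (z ∘ φ) atTop (𝓝 v))
    (z' : ℕ → G') (hz' : ∀ n, z' n ∈ S'†.domain) (C : ℝ)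
    (hC : ∀ n, ‖z' n‖ ^ 2 + ‖S'† ⟨z' n, hz' n⟩‖ ^ 2 ≤ C ^ 2) :
    ∃ v' : G', ∃ φ : ℕ → ℕ, StrictMono φ ∧ Tendsto (z' ∘ φ) atTop (𝓝 v') := by
  have hmap := fun n ↦ adjoint_map_of_map (T := S') (T' := S) (k_E := g_F) (k_F := g_G) hdS' hdS hgS (z' n) (hz' n)
  have hx : ∀ n, ContinuousLinearMap.adjoint g_G (z' n) ∈ S†.domain := fun n ↦ (hmap n).1
  have hxS : ∀ n, S† ⟨ContinuousLinearMap.adjoint g_G (z' n), hx n⟩ =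
      ContinuousLinearMap.adjoint g_F (S'† ⟨z' n, hz' n⟩) := fun n ↦ (hmap n).2
  have hb : ∀ n, ‖z' n‖ ≤ |C| ∧ ‖S'† ⟨z' n, hz' n⟩‖ ≤ |C| := fun n ↦ by
    have h := le_abs_of_form_bound (a := ‖z' n‖) (b := ‖S'† ⟨z' n, hz' n⟩‖) (c := 0) (C := C)
      (by simpa using hC n)
    exact ⟨h.1, h.2.1⟩
  obtain ⟨v, φ, hφ, hv⟩ := hR (fun n ↦ ContinuousLinearMap.adjoint g_G (z' n)) hx (‖g_G‖ * |C| + ‖g_F‖ * |C|)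
    fun n ↦ by
    have h1 : ‖ContinuousLinearMap.adjoint g_G (z' n)‖ ≤ ‖g_G‖ * |C| :=
      (norm_adjoint_apply_le_opNorm g_G _).trans (mul_le_mul_of_nonneg_left (hb n).1 (norm_nonneg _))
    have h2 : ‖S† ⟨ContinuousLinearMap.adjoint g_G (z' n), hx n⟩‖ ≤ ‖g_F‖ * |C| := by
      rw [hxS n]
      exact (norm_adjoint_apply_le_opNorm g_F _).trans (mul_le_mul_of_nonneg_left (hb n).2 (norm_nonneg _))
    have h3 : 0 ≤ ‖g_G‖ * |C| := by positivity
    have h4 : 0 ≤ ‖g_F‖ * |C| := by positivity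
    nlinarith [norm_nonneg (ContinuousLinearMap.adjoint g_G (z' n)),
      norm_nonneg (S† ⟨ContinuousLinearMap.adjoint g_G (z' n), hx n⟩)]
  refine ⟨ContinuousLinearMap.adjoint k_G v, φ, hφ, ?_⟩
  have hfun : z' ∘ φ = fun n ↦ ContinuousLinearMap.adjoint k_G
      ((fun n ↦ ContinuousLinearMap.adjoint g_G (z' n)) (φ n)) := by
    funext n
    simp only [Function.comp_apply, adjoint_apply_adjoint_apply_of_leftInverse hgk_G]
  rw [hfun]
  exact ((ContinuousLinearMap.adjoint k_G).continuous.tendsto v).comp hv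

/-! ### §3 Middle degree: the Rellich property of `‖u‖² + ‖T*u‖² + ‖Su‖²` on `D(T*) ∩ D(S)` passes along an isomorphism -/

omit [NormedAddCommGroup G] [InnerProductSpace 𝕜 G] [NormedAddCommGroup G'] [InnerProductSpace 𝕜 G'] in
/-- `(Ker T*)^⊥ = cl Im T` (pmapKer form). [cite: BruningLesch1992, §2 (2.4) (weak Hodge decomposition)] -/
private theorem orthogonal_pmapKer_adjoint_eq_closure_range [CompleteSpace E] [CompleteSpace F]
    (hdT : Dense (T.domain : Set E)) :
    ((LinearMap.ker T†.toFun).map T†.domain.subtype)ᗮ = (LinearMap.range T.toFun).topologicalClosure := by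
  rw [← orthogonal_range_eq_ker_adjoint hdT, Submodule.orthogonal_orthogonal_eq_closure]

/-- **Middle degree — the compactness property is an isomorphism invariant.** Let `(E, F, G; T, S)` and
`(E′, F′, G′; T′, S′)` be Hilbert complexes (`T`, `T′` densely defined, `S`, `S′` closed, `Im T ⊆ Ker S`, `Im T′ ⊆ Ker S′`)
and let bounded `g`, `k` satisfy: `(g_E, g_F)` is a map `T → T′` (`hgT`), `(k_E, k_F)` a map `T′ → T` (`hkT`), `(k_F, k_G)`
a map `S′ → S` (`hkS`), and `g_F ∘ k_F = id`. If every sequence `uₙ ∈ D(T*) ∩ D(S)` with `‖uₙ‖² + ‖T*uₙ‖² + ‖Suₙ‖² ≤ C²`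
has a convergent subsequence, then so does every such sequence for `(T′, S′)`. Proof (Brüning–Lesch's `k = h ⊕ g` on
the weak Hodge decomposition, run backwards and sequentially): split `u′ₙ = P_{Ker T′*}u′ₙ + P_{cl Im T′}u′ₙ =: a′ₙ + b′ₙ`
(`a′ₙ ∈ D(S′)`, `S′a′ₙ = S′u′ₙ`; `b′ₙ ∈ D(T′*)`, `T′*b′ₙ = T′*u′ₙ`); `vₙ := P_{Ker T*}(k_F a′ₙ)` has `T*vₙ = 0`,
`Svₙ = k_G S′u′ₙ`; `wₙ := P_{cl Im T}(g_F*b′ₙ)` has `Swₙ = 0`, `T*wₙ = g_E*T′*u′ₙ`; both are form-bounded, hence converge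
along a common subsequence, and `a′ₙ = P_{Ker T′*}(g_F vₙ)`, `b′ₙ = P_{cl Im T′}(k_F*wₙ)`. [cite: BruningLesch1992, §2
Lemma 2.17 ("Discreteness is invariant under complex isomorphisms") with (2.50)–(2.51) and Lemma 2.7; ArnoldFalkWinther2010,
§3.1 (compactness property); Schmudgen2012, Prop. 10.6] -/
theorem rellich_of_iso [CompleteSpace E] [CompleteSpace F] [CompleteSpace E'] [CompleteSpace F']
    (hdT : Dense (T.domain : Set E)) (hcS : S.IsClosed)
    (hST : LinearMap.range T.toFun ≤ (LinearMap.ker S.toFun).map S.domain.subtype)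
    (hdT' : Dense (T'.domain : Set E')) (hcS' : S'.IsClosed)
    (hST' : LinearMap.range T'.toFun ≤ (LinearMap.ker S'.toFun).map S'.domain.subtype)
    (hgT : ∀ (w : E) (hw : w ∈ T.domain), ∃ h : g_E w ∈ T'.domain, T' ⟨g_E w, h⟩ = g_F (T ⟨w, hw⟩))
    (hkT : ∀ (w' : E') (hw' : w' ∈ T'.domain), ∃ h : k_E w' ∈ T.domain, T ⟨k_E w', h⟩ = k_F (T' ⟨w', hw'⟩))
    (hkS : ∀ (u' : F') (hu' : u' ∈ S'.domain), ∃ h : k_F u' ∈ S.domain, S ⟨k_F u', h⟩ = k_G (S' ⟨u', hu'⟩))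
    (hgk_F : ∀ u' : F', g_F (k_F u') = u')
    (hR : ∀ (u : ℕ → F) (huT : ∀ n, u n ∈ T†.domain) (huS : ∀ n, u n ∈ S.domain) (C : ℝ),
      (∀ n, ‖u n‖ ^ 2 + (‖T† ⟨u n, huT n⟩‖ ^ 2 + ‖S ⟨u n, huS n⟩‖ ^ 2) ≤ C ^ 2) →
        ∃ v : F, ∃ φ : ℕ → ℕ, StrictMono φ ∧ Tendsto (u ∘ φ) atTop (𝓝 v))
    (u' : ℕ → F') (hu'T : ∀ n, u' n ∈ T'†.domain) (hu'S : ∀ n, u' n ∈ S'.domain) (C : ℝ)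
    (hC : ∀ n, ‖u' n‖ ^ 2 + (‖T'† ⟨u' n, hu'T n⟩‖ ^ 2 + ‖S' ⟨u' n, hu'S n⟩‖ ^ 2) ≤ C ^ 2) :
    ∃ v' : F', ∃ φ : ℕ → ℕ, StrictMono φ ∧ Tendsto (u' ∘ φ) atTop (𝓝 v') := by
  -- the closed subspaces `Ker T*`, `Ker T′*` and their complements `cl Im T`, `cl Im T′`
  set K : Submodule 𝕜 F := (LinearMap.ker T†.toFun).map T†.domain.subtype with hK
  set K' : Submodule 𝕜 F' := (LinearMap.ker T'†.toFun).map T'†.domain.subtype with hK'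
  haveI : CompleteSpace K := (isClosed_pmapKer (LinearPMap.adjoint_isClosed hdT)).completeSpace_coe
  haveI : CompleteSpace K' := (isClosed_pmapKer (LinearPMap.adjoint_isClosed hdT')).completeSpace_coe
  have hKo : Kᗮ = (LinearMap.range T.toFun).topologicalClosure := orthogonal_pmapKer_adjoint_eq_closure_range hdT
  have hKo' : K'ᗮ = (LinearMap.range T'.toFun).topologicalClosure := orthogonal_pmapKer_adjoint_eq_closure_range hdT'
  have hKoS : ∀ y ∈ Kᗮ, y ∈ (LinearMap.ker S.toFun).map S.domain.subtype := fun y hy ↦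
    closure_range_le_ker hcS hST (by rw [← hKo]; exact hy)
  have hKoS' : ∀ y ∈ K'ᗮ, y ∈ (LinearMap.ker S'.toFun).map S'.domain.subtype := fun y hy ↦
    closure_range_le_ker hcS' hST' (by rw [← hKo']; exact hy)
  -- bounds on the given sequence
  have hb : ∀ n, ‖u' n‖ ≤ |C| ∧ ‖T'† ⟨u' n, hu'T n⟩‖ ≤ |C| ∧ ‖S' ⟨u' n, hu'S n⟩‖ ≤ |C| := fun n ↦
    le_abs_of_form_bound (hC n)
  -- the splitting `u′ₙ = a′ₙ + b′ₙ`
  set a : ℕ → F' := fun n ↦ K'.starProjection (u' n) with ha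
  set b : ℕ → F' := fun n ↦ K'ᗮ.starProjection (u' n) with hb'
  have hab : ∀ n, a n + b n = u' n := fun n ↦ Submodule.starProjection_add_starProjection_orthogonal (K := K') (u' n)
  have haK : ∀ n, a n ∈ K' := fun n ↦ Submodule.starProjection_apply_mem K' (u' n)
  have hbKo : ∀ n, b n ∈ K'ᗮ := fun n ↦ Submodule.starProjection_apply_mem K'ᗮ (u' n)
  have haT : ∀ n, a n ∈ T'†.domain := fun n ↦ (mem_pmapKer_iff.1 (haK n)).1
  have haT0 : ∀ n, T'† ⟨a n, haT n⟩ = 0 := fun n ↦ (mem_pmapKer_iff.1 (haK n)).2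
  have hbS : ∀ n, b n ∈ S'.domain := fun n ↦ (mem_pmapKer_iff.1 (hKoS' _ (hbKo n))).1
  have hbS0 : ∀ n, S' ⟨b n, hbS n⟩ = 0 := fun n ↦ (mem_pmapKer_iff.1 (hKoS' _ (hbKo n))).2
  have haS : ∀ n, a n ∈ S'.domain := fun n ↦ by
    rw [eq_sub_of_add_eq (hab n)]; exact S'.domain.sub_mem (hu'S n) (hbS n)
  have haSval : ∀ n, S' ⟨a n, haS n⟩ = S' ⟨u' n, hu'S n⟩ := fun n ↦ by
    have e : (⟨a n, haS n⟩ : S'.domain) = ⟨u' n, hu'S n⟩ - ⟨b n, hbS n⟩ := Subtype.ext (eq_sub_of_add_eq (hab n))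
    rw [e, LinearPMap.map_sub, hbS0 n, sub_zero]
  have hbT : ∀ n, b n ∈ T'†.domain := fun n ↦ by
    rw [eq_sub_of_add_eq' (hab n)]; exact T'†.domain.sub_mem (hu'T n) (haT n)
  have hbTval : ∀ n, T'† ⟨b n, hbT n⟩ = T'† ⟨u' n, hu'T n⟩ := fun n ↦ by
    have e : (⟨b n, hbT n⟩ : T'†.domain) = ⟨u' n, hu'T n⟩ - ⟨a n, haT n⟩ := Subtype.ext (eq_sub_of_add_eq' (hab n))
    rw [e, LinearPMap.map_sub, haT0 n, sub_zero]
  have ha_le : ∀ n, ‖a n‖ ≤ |C| := fun n ↦ (Submodule.norm_starProjection_apply_le _ (u' n)).trans (hb n).1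
  have hb_le : ∀ n, ‖b n‖ ≤ |C| := fun n ↦ (Submodule.norm_starProjection_apply_le _ (u' n)).trans (hb n).1
  -- Step A: `vₙ := P_{Ker T*}(k_F a′ₙ)`
  have hka : ∀ n, k_F (a n) ∈ S.domain := fun n ↦ (hkS (a n) (haS n)).1
  have hkaS : ∀ n, S ⟨k_F (a n), hka n⟩ = k_G (S' ⟨a n, haS n⟩) := fun n ↦ (hkS (a n) (haS n)).2
  set v : ℕ → F := fun n ↦ K.starProjection (k_F (a n)) with hv
  have hvK : ∀ n, v n ∈ K := fun n ↦ Submodule.starProjection_apply_mem K _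
  have hvT : ∀ n, v n ∈ T†.domain := fun n ↦ (mem_pmapKer_iff.1 (hvK n)).1
  have hvT0 : ∀ n, T† ⟨v n, hvT n⟩ = 0 := fun n ↦ (mem_pmapKer_iff.1 (hvK n)).2
  have hvc : ∀ n, v n + Kᗮ.starProjection (k_F (a n)) = k_F (a n) := fun n ↦
    Submodule.starProjection_add_starProjection_orthogonal (K := K) _
  have hcS_mem : ∀ n, Kᗮ.starProjection (k_F (a n)) ∈ S.domain := fun n ↦
    (mem_pmapKer_iff.1 (hKoS _ (Submodule.starProjection_apply_mem Kᗮ _))).1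
  have hcS0 : ∀ n, S ⟨Kᗮ.starProjection (k_F (a n)), hcS_mem n⟩ = 0 := fun n ↦
    (mem_pmapKer_iff.1 (hKoS _ (Submodule.starProjection_apply_mem Kᗮ _))).2
  have hvS : ∀ n, v n ∈ S.domain := fun n ↦ by
    rw [eq_sub_of_add_eq (hvc n)]; exact S.domain.sub_mem (hka n) (hcS_mem n)
  have hvSval : ∀ n, S ⟨v n, hvS n⟩ = k_G (S' ⟨u' n, hu'S n⟩) := fun n ↦ by
    have e : (⟨v n, hvS n⟩ : S.domain) = ⟨k_F (a n), hka n⟩ - ⟨Kᗮ.starProjection (k_F (a n)), hcS_mem n⟩ :=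
      Subtype.ext (eq_sub_of_add_eq (hvc n))
    rw [e, LinearPMap.map_sub, hcS0 n, sub_zero, hkaS n, haSval n]
  obtain ⟨v₀, φ₁, hφ₁, hv₀⟩ := hR v hvT hvS (‖k_F‖ * |C| + ‖k_G‖ * |C|) fun n ↦ by
    have h1 : ‖v n‖ ≤ ‖k_F‖ * |C| := (Submodule.norm_starProjection_apply_le K _).trans
      ((k_F.le_opNorm _).trans (mul_le_mul_of_nonneg_left (ha_le n) (norm_nonneg _)))
    have h2 : ‖S ⟨v n, hvS n⟩‖ ≤ ‖k_G‖ * |C| := by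
      rw [hvSval n]
      exact (k_G.le_opNorm _).trans (mul_le_mul_of_nonneg_left (hb n).2.2 (norm_nonneg _))
    have h3 : 0 ≤ ‖k_F‖ * |C| := by positivity
    have h4 : 0 ≤ ‖k_G‖ * |C| := by positivity
    rw [hvT0 n, norm_zero]
    nlinarith [norm_nonneg (v n), norm_nonneg (S ⟨v n, hvS n⟩)]
  -- Step B: `wₙ := P_{cl Im T}(g_F* b′_{φ₁ n})`
  have hgb := fun n ↦ adjoint_map_of_map (T := T') (T' := T) (k_E := g_E) (k_F := g_F) hdT' hdT hgT (b n) (hbT n)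
  have hgbT : ∀ n, ContinuousLinearMap.adjoint g_F (b n) ∈ T†.domain := fun n ↦ (hgb n).1
  have hgbTval : ∀ n, T† ⟨ContinuousLinearMap.adjoint g_F (b n), hgbT n⟩ =
      ContinuousLinearMap.adjoint g_E (T'† ⟨u' n, hu'T n⟩) := fun n ↦ by rw [(hgb n).2, hbTval n]
  set w : ℕ → F := fun n ↦ Kᗮ.starProjection (ContinuousLinearMap.adjoint g_F (b (φ₁ n))) with hw
  have hwKo : ∀ n, w n ∈ Kᗮ := fun n ↦ Submodule.starProjection_apply_mem Kᗮ _
  have hwS : ∀ n, w n ∈ S.domain := fun n ↦ (mem_pmapKer_iff.1 (hKoS _ (hwKo n))).1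
  have hwS0 : ∀ n, S ⟨w n, hwS n⟩ = 0 := fun n ↦ (mem_pmapKer_iff.1 (hKoS _ (hwKo n))).2
  have hwc : ∀ n, K.starProjection (ContinuousLinearMap.adjoint g_F (b (φ₁ n))) + w n =
      ContinuousLinearMap.adjoint g_F (b (φ₁ n)) := fun n ↦
    Submodule.starProjection_add_starProjection_orthogonal (K := K) _
  have hKw_mem : ∀ n, K.starProjection (ContinuousLinearMap.adjoint g_F (b (φ₁ n))) ∈ T†.domain := fun n ↦
    (mem_pmapKer_iff.1 (Submodule.starProjection_apply_mem K _)).1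
  have hKw0 : ∀ n, T† ⟨K.starProjection (ContinuousLinearMap.adjoint g_F (b (φ₁ n))), hKw_mem n⟩ = 0 := fun n ↦
    (mem_pmapKer_iff.1 (Submodule.starProjection_apply_mem K _)).2
  have hwT : ∀ n, w n ∈ T†.domain := fun n ↦ by
    rw [eq_sub_of_add_eq' (hwc n)]; exact T†.domain.sub_mem (hgbT _) (hKw_mem n)
  have hwTval : ∀ n, T† ⟨w n, hwT n⟩ = ContinuousLinearMap.adjoint g_E (T'† ⟨u' (φ₁ n), hu'T (φ₁ n)⟩) :=
    fun n ↦ by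
    have e : (⟨w n, hwT n⟩ : T†.domain) = ⟨ContinuousLinearMap.adjoint g_F (b (φ₁ n)), hgbT _⟩ -
        ⟨K.starProjection (ContinuousLinearMap.adjoint g_F (b (φ₁ n))), hKw_mem n⟩ :=
      Subtype.ext (eq_sub_of_add_eq' (hwc n))
    rw [e, LinearPMap.map_sub, hKw0 n, sub_zero, hgbTval]
  obtain ⟨w₀, φ₂, hφ₂, hw₀⟩ := hR w hwT hwS (‖g_F‖ * |C| + ‖g_E‖ * |C|) fun n ↦ by
    have h1 : ‖w n‖ ≤ ‖g_F‖ * |C| := (Submodule.norm_starProjection_apply_le Kᗮ _).trans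
      ((norm_adjoint_apply_le_opNorm g_F _).trans (mul_le_mul_of_nonneg_left (hb_le _) (norm_nonneg _)))
    have h2 : ‖T† ⟨w n, hwT n⟩‖ ≤ ‖g_E‖ * |C| := by
      rw [hwTval n]
      exact (norm_adjoint_apply_le_opNorm g_E _).trans (mul_le_mul_of_nonneg_left (hb _).2.1 (norm_nonneg _))
    have h3 : 0 ≤ ‖g_F‖ * |C| := by positivity
    have h4 : 0 ≤ ‖g_E‖ * |C| := by positivity
    rw [hwS0 n, norm_zero]
    nlinarith [norm_nonneg (w n), norm_nonneg (T† ⟨w n, hwT n⟩)]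
  -- recovery of `a′ₙ`, `b′ₙ` from `vₙ`, `wₙ`
  have hrecA : ∀ n, K'.starProjection (g_F (v n)) = a n := fun n ↦ by
    have h2 : g_F (Kᗮ.starProjection (k_F (a n))) ∈ K'ᗮ := by
      rw [hKo']
      apply apply_mem_closure_range_of_map hgT
      rw [← hKo]
      exact Submodule.starProjection_apply_mem Kᗮ _
    calc K'.starProjection (g_F (v n))
        = K'.starProjection (g_F (v n)) + K'.starProjection (g_F (Kᗮ.starProjection (k_F (a n)))) := by
          rw [starProjection_eq_zero_of_mem_orthogonal h2, add_zero]
      _ = K'.starProjection (g_F (v n + Kᗮ.starProjection (k_F (a n)))) := by rw [map_add, map_add]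
      _ = K'.starProjection (a n) := by rw [hvc n, hgk_F]
      _ = a n := Submodule.starProjection_eq_self_iff.2 (haK n)
  have hkKer := adjoint_map_of_map (T := T) (T' := T') (k_E := k_E) (k_F := k_F) hdT hdT' hkT
  have hrecB : ∀ n, K'ᗮ.starProjection (ContinuousLinearMap.adjoint k_F (w n)) = b (φ₁ n) := fun n ↦ by
    have hκ : ContinuousLinearMap.adjoint k_F (K.starProjection (ContinuousLinearMap.adjoint g_F (b (φ₁ n)))) ∈ K' :=
      apply_mem_pmapKer_of_map hkKer (Submodule.starProjection_apply_mem K _)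
    calc K'ᗮ.starProjection (ContinuousLinearMap.adjoint k_F (w n))
        = K'ᗮ.starProjection (ContinuousLinearMap.adjoint k_F
            (K.starProjection (ContinuousLinearMap.adjoint g_F (b (φ₁ n))))) +
          K'ᗮ.starProjection (ContinuousLinearMap.adjoint k_F (w n)) := by
          rw [Submodule.starProjection_orthogonal_apply_eq_zero hκ, zero_add]
      _ = K'ᗮ.starProjection (ContinuousLinearMap.adjoint k_F
            (K.starProjection (ContinuousLinearMap.adjoint g_F (b (φ₁ n))) + w n)) := by rw [map_add, map_add]
      _ = K'ᗮ.starProjection (b (φ₁ n)) := by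
          rw [hwc n, adjoint_apply_adjoint_apply_of_leftInverse hgk_F]
      _ = b (φ₁ n) := Submodule.starProjection_eq_self_iff.2 (hbKo _)
  -- the limit along `φ₁ ∘ φ₂`
  refine ⟨K'.starProjection (g_F v₀) + K'ᗮ.starProjection (ContinuousLinearMap.adjoint k_F w₀), φ₁ ∘ φ₂,
    hφ₁.comp hφ₂, ?_⟩
  have hfun : u' ∘ (φ₁ ∘ φ₂) = fun n ↦ K'.starProjection (g_F ((v ∘ φ₁) (φ₂ n))) +
      K'ᗮ.starProjection (ContinuousLinearMap.adjoint k_F (w (φ₂ n))) := by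
    funext n
    simp only [Function.comp_apply]
    rw [hrecA, hrecB, hab]
  rw [hfun]
  have hv' : Tendsto (fun n ↦ (v ∘ φ₁) (φ₂ n)) atTop (𝓝 v₀) := hv₀.comp hφ₂.tendsto_atTop
  have hA : Tendsto (fun n ↦ K'.starProjection (g_F ((v ∘ φ₁) (φ₂ n)))) atTop (𝓝 (K'.starProjection (g_F v₀))) :=
    ((K'.starProjection.comp g_F).continuous.tendsto v₀).comp hv'
  have hB : Tendsto (fun n ↦ K'ᗮ.starProjection (ContinuousLinearMap.adjoint k_F (w (φ₂ n)))) atTop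
      (𝓝 (K'ᗮ.starProjection (ContinuousLinearMap.adjoint k_F w₀))) :=
    ((K'ᗮ.starProjection.comp (ContinuousLinearMap.adjoint k_F)).continuous.tendsto w₀).comp hw₀
  exact hA.add hB

end Literature.Analysis.InnerProduct
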